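import Summits.KontsevichZagierPeriods.Zeta5Search.Certificates.BinomialSumBounds
import Summits.KontsevichZagierPeriods.Zeta5Search.WedgeDictionary
import HarnessLib

/-!
# ζ(5) search — certificates: the term of the dual very-well-poised series (34) as a ratio of binomials (certifier 2)

HONEST FRAMING: systematic search; no irrationality claim unless certified.

OUR work (Summit side; generic layer of the DECAY side, CERTIFY-HOWTO §9 roadmap (D1)). For natural dual parameters
`b = (B₀; B₁,…,B₇)` in the region `2B_j ≤ B₀ + 1` the `μ`-th term of `F̃₇(b) = Σ_μ term (natB B₀ B) μ` (`DualSeries.term`, the printed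
series (34) with `k = 7`) is

* `term_eq_factorial` — `term (natB B₀ B) μ = (B₀+2μ+2)·(B₀+μ+1)!·∏_j (B_j+μ)! / (μ!·∏_j (B₀−B_j+μ+1)!)` (all Gamma values at
  positive integers; the sign `(−1)^{8μ} = 1`);
* `term_pos` — hence `term (natB B₀ B) μ > 0`: `F̃₇` is a series of POSITIVE terms;
* `term_eq_normalised` — `term (natB B₀ B) μ = Z(b)·T̂(b,μ)` with the `μ`-free normaliser `Z(b) = (B₀+1)!/∏_j (B₀+1−2B_j)!`
  (`termNorm`) and the RATIO OF BINOMIALS `T̂(b,μ) = (B₀+2μ+2)·C(B₀+μ+1, μ)/∏_j C(B₀−B_j+μ+1, B_j+μ)` (`termHat`) — so along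
  a ray `b = β·n` the normalised series `F̃₇/Z` has a purely EXPONENTIAL rate (entropies of binomials), exactly as `Q(a·n)`;
* `vwpDual_seven_pos`, `termNorm_mul_termHat_le_vwpDual` — `F̃₇(b) > 0` and the single-term lower bound
  `Z·T̂(μ₀) ≤ F̃₇(b)`;
* `vwpDual_seven_le_of_bounds` — the upper-bound scheme: `F̃₇(b) ≤ Z·S` whenever `Σ_μ T̂(b,μ) ≤ S` termwise-summably.

The ray-specific inputs (unimodality of `T̂` in `μ` from two coefficientwise-positive polynomial identities, the window bound,
the tail) are supplied per ray (`Certificates/RecordRayDualSeries.lean`). Nothing here is specific to ζ(5).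
-/

noncomputable section

open Finset Real

namespace Summit.KontsevichZagierPeriods.Zeta5Search.DualSeriesBounds

open Summit.KontsevichZagierPeriods.Zeta5Search.DualSeries
open Summit.KontsevichZagierPeriods.Zeta5Search.WedgeDictionary
open Literature.NumberTheory.Irrationality.BrownZudilin2022 (vwpDual)

/-- Natural dual parameters `b = (B₀; B 0, …, B 6)` as an integer vector (`0` beyond slot 7). -/
def natB (B₀ : ℕ) (B : ℕ → ℕ) : ℕ → ℤ := fun j => if j = 0 then (B₀ : ℤ) else if j ≤ 7 then (B (j - 1) : ℤ) else 0

variable {B₀ : ℕ} {B : ℕ → ℕ}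

/-- `natB B₀ B 0 = B₀`. -/
@[simp] theorem natB_zero (B₀ : ℕ) (B : ℕ → ℕ) : natB B₀ B 0 = B₀ := by simp [natB]

/-- `natB B₀ B (j+1) = B j` for `j < 7`. -/
theorem natB_succ (B₀ : ℕ) (B : ℕ → ℕ) {j : ℕ} (hj : j ∈ range 7) : natB B₀ B (j + 1) = B j := by
  have := mem_range.1 hj
  simp [natB, show j + 1 ≤ 7 by omega]

/-- Natural parameters with `B j ≤ B₀` lie in the box of `DualSeries`. -/
theorem inBox_natB (hle : ∀ j ∈ range 7, B j ≤ B₀) : InBox (natB B₀ B) := by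
  refine ⟨by rw [natB_zero]; positivity, fun j hj => ?_⟩
  rw [natB_succ B₀ B hj, natB_zero]
  have := hle j hj
  constructor
  · positivity
  · exact_mod_cast Nat.le_succ_of_le this

/-- **Factorial form of the term of (34)**:
`term (natB B₀ B) μ = (B₀+2μ+2)·(B₀+μ+1)!·∏_j (B_j+μ)! / (μ!·∏_j (B₀−B_j+μ+1)!)`. -/
theorem term_eq_factorial (hle : ∀ j ∈ range 7, B j ≤ B₀) (μ : ℕ) :
    term (natB B₀ B) μ = ((B₀ + 2 * μ + 2 : ℕ) : ℝ) *
      (((B₀ + μ + 1).factorial : ℝ) * ∏ j ∈ range 7, (((B j + μ).factorial : ℕ) : ℝ)) /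
      ((μ.factorial : ℝ) * ∏ j ∈ range 7, (((B₀ - B j + μ + 1).factorial : ℕ) : ℝ)) := by
  unfold term
  have h0 : ((natB B₀ B 0 : ℤ) : ℝ) = B₀ := by rw [natB_zero B₀ B]; push_cast; ring
  have hsign : (-1 : ℝ) ^ ((7 + 1) * μ) = 1 := by
    rw [show (7 + 1) * μ = 2 * (4 * μ) by ring, pow_mul]; simp
  rw [hsign, mul_one]
  have e0 : Real.Gamma (((natB B₀ B 0 : ℤ) : ℝ) + μ + 2) = ((B₀ + μ + 1).factorial : ℝ) := by
    rw [h0, show (B₀ : ℝ) + μ + 2 = ((B₀ + μ + 1 : ℕ) : ℝ) + 1 by push_cast; ring, Real.Gamma_nat_eq_factorial]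
  have e1 : ∀ j ∈ range 7, Real.Gamma (((natB B₀ B (j + 1) : ℤ) : ℝ) + μ + 1) = (((B j + μ).factorial : ℕ) : ℝ) := by
    intro j hj
    rw [natB_succ B₀ B hj, show ((B j : ℤ) : ℝ) + μ + 1 = ((B j + μ : ℕ) : ℝ) + 1 by push_cast; ring,
      Real.Gamma_nat_eq_factorial]
  have e2 : ∀ j ∈ range 7, Real.Gamma (((natB B₀ B 0 : ℤ) : ℝ) - ((natB B₀ B (j + 1) : ℤ) : ℝ) + μ + 2) =
      (((B₀ - B j + μ + 1).factorial : ℕ) : ℝ) := by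
    intro j hj
    have hle' := hle j hj
    rw [h0, natB_succ B₀ B hj, show (B₀ : ℝ) - ((B j : ℤ) : ℝ) + μ + 2 = ((B₀ - B j + μ + 1 : ℕ) : ℝ) + 1 by
      rw [Nat.cast_add, Nat.cast_add, Nat.cast_sub hle']; push_cast; ring, Real.Gamma_nat_eq_factorial]
  rw [e0, prod_congr rfl e1, prod_congr rfl e2, h0]
  push_cast
  ring

/-- **Every term of (34) is positive** (natural parameters in the region). -/
theorem term_pos (hle : ∀ j ∈ range 7, B j ≤ B₀) (μ : ℕ) : 0 < term (natB B₀ B) μ := by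
  rw [term_eq_factorial hle μ]
  have : (0 : ℝ) < ((B₀ + 2 * μ + 2 : ℕ) : ℝ) := by positivity
  apply div_pos
  · apply mul_pos this (mul_pos (by positivity) (prod_pos fun j _ => by positivity))
  · exact mul_pos (by positivity) (prod_pos fun j _ => by positivity)

/-- The `μ`-free normaliser `Z(b) = (B₀+1)!/∏_j (B₀+1−2B_j)!`. -/
def termNorm (B₀ : ℕ) (B : ℕ → ℕ) : ℝ :=
  ((B₀ + 1).factorial : ℝ) / ∏ j ∈ range 7, (((B₀ + 1 - 2 * B j).factorial : ℕ) : ℝ)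

/-- The normalised term `T̂(b,μ) = (B₀+2μ+2)·C(B₀+μ+1, μ)/∏_j C(B₀−B_j+μ+1, B_j+μ)` — a ratio of binomials. -/
def termHat (B₀ : ℕ) (B : ℕ → ℕ) (μ : ℕ) : ℝ :=
  ((B₀ + 2 * μ + 2 : ℕ) : ℝ) * ((B₀ + μ + 1).choose μ : ℝ) /
    ∏ j ∈ range 7, (((B₀ - B j + μ + 1).choose (B j + μ) : ℕ) : ℝ)

/-- `Z(b) > 0`. -/
theorem termNorm_pos (B₀ : ℕ) (B : ℕ → ℕ) : 0 < termNorm B₀ B := by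
  unfold termNorm
  exact div_pos (by positivity) (prod_pos fun j _ => by positivity)

/-- `T̂(b,μ) > 0` in the region. -/
theorem termHat_pos (hreg : ∀ j ∈ range 7, 2 * B j ≤ B₀ + 1) (μ : ℕ) : 0 < termHat B₀ B μ := by
  unfold termHat
  have : (0 : ℝ) < ((B₀ + 2 * μ + 2 : ℕ) : ℝ) := by positivity
  refine div_pos (mul_pos this (by exact_mod_cast Nat.choose_pos (by omega))) (prod_pos fun j hj => ?_)
  have := hreg j hj
  exact_mod_cast Nat.choose_pos (by omega)

/-- `(B₀+1)!·C(B₀+μ+1, μ)·μ! = (B₀+μ+1)!` (cast). -/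
theorem numerator_identity (B₀ μ : ℕ) :
    ((B₀ + 1).factorial : ℝ) * ((B₀ + μ + 1).choose μ : ℝ) * (μ.factorial : ℝ) = ((B₀ + μ + 1).factorial : ℝ) := by
  have h := Nat.choose_mul_factorial_mul_factorial (show μ ≤ B₀ + μ + 1 by omega)
  rw [show B₀ + μ + 1 - μ = B₀ + 1 by omega] at h
  have h' : (((B₀ + μ + 1).choose μ : ℕ) : ℝ) * (μ.factorial : ℝ) * ((B₀ + 1).factorial : ℝ) =
      ((B₀ + μ + 1).factorial : ℝ) := by exact_mod_cast h
  linarith [h']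

/-- `(B₀+1−2B_j)!·C(B₀−B_j+μ+1, B_j+μ)·(B_j+μ)! = (B₀−B_j+μ+1)!` (cast), for `2B_j ≤ B₀+1`, `B_j ≤ B₀`. -/
theorem denominator_identity {B₀ Bj : ℕ} (hreg : 2 * Bj ≤ B₀ + 1) (hle : Bj ≤ B₀) (μ : ℕ) :
    (((B₀ + 1 - 2 * Bj).factorial : ℕ) : ℝ) * (((B₀ - Bj + μ + 1).choose (Bj + μ) : ℕ) : ℝ) * (((Bj + μ).factorial : ℕ) : ℝ)
      = (((B₀ - Bj + μ + 1).factorial : ℕ) : ℝ) := by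
  have h := Nat.choose_mul_factorial_mul_factorial (show Bj + μ ≤ B₀ - Bj + μ + 1 by omega)
  rw [show B₀ - Bj + μ + 1 - (Bj + μ) = B₀ + 1 - 2 * Bj by omega] at h
  have h' : (((B₀ - Bj + μ + 1).choose (Bj + μ) : ℕ) : ℝ) * (((Bj + μ).factorial : ℕ) : ℝ) *
      (((B₀ + 1 - 2 * Bj).factorial : ℕ) : ℝ) = (((B₀ - Bj + μ + 1).factorial : ℕ) : ℝ) := by exact_mod_cast h
  linarith [h']

/-- **Normalised form**: `term (natB B₀ B) μ = Z(b)·T̂(b,μ)`. -/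
theorem term_eq_normalised (hle : ∀ j ∈ range 7, B j ≤ B₀) (hreg : ∀ j ∈ range 7, 2 * B j ≤ B₀ + 1) (μ : ℕ) : term (natB B₀ B) μ = termNorm B₀ B * termHat B₀ B μ := by
  rw [term_eq_factorial hle μ]
  unfold termNorm termHat
  have hμ : (μ.factorial : ℝ) ≠ 0 := by positivity
  have hD : ∀ j ∈ range 7, (((B₀ - B j + μ + 1).factorial : ℕ) : ℝ) =
      (((B₀ + 1 - 2 * B j).factorial : ℕ) : ℝ) * (((B₀ - B j + μ + 1).choose (B j + μ) : ℕ) : ℝ) *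
        (((B j + μ).factorial : ℕ) : ℝ) := fun j hj => (denominator_identity (hreg j hj) (hle j hj) μ).symm
  have hN : ((B₀ + μ + 1).factorial : ℝ) = ((B₀ + 1).factorial : ℝ) * ((B₀ + μ + 1).choose μ : ℝ) * (μ.factorial : ℝ) :=
    (numerator_identity B₀ μ).symm
  rw [prod_congr rfl hD, prod_mul_distrib, prod_mul_distrib, hN]
  have hP1 : (0 : ℝ) < ∏ j ∈ range 7, (((B₀ + 1 - 2 * B j).factorial : ℕ) : ℝ) := prod_pos fun j _ => by positivity
  have hP2 : (0 : ℝ) < ∏ j ∈ range 7, (((B₀ - B j + μ + 1).choose (B j + μ) : ℕ) : ℝ) :=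
    prod_pos fun j hj => by have := hreg j hj; exact_mod_cast Nat.choose_pos (by omega)
  have hP3 : (0 : ℝ) < ∏ j ∈ range 7, (((B j + μ).factorial : ℕ) : ℝ) := prod_pos fun j _ => by positivity
  field_simp

/-- The summability hypothesis of the tree for `natB`, from `Σ_j B j ≤ 3B₀ + 1`. -/
theorem hsum_of (hs : ∑ j ∈ range 7, B j ≤ 3 * B₀ + 1) :
    ∑ j ∈ range 7, natB B₀ B (j + 1) ≤ 3 * natB B₀ B 0 + 1 := by
  rw [natB_zero, sum_congr rfl (fun j hj => natB_succ B₀ B hj)]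
  exact_mod_cast hs

/-- **`F̃₇(b)` is the sum of its (positive) terms** and is positive. -/
theorem vwpDual_seven_pos (hle : ∀ j ∈ range 7, B j ≤ B₀) (hs : ∑ j ∈ range 7, B j ≤ 3 * B₀ + 1) :
    0 < vwpDual 7 (natB B₀ B) := by
  have hS := (vwp_decomposition (natB B₀ B) (inBox_natB hle) (hsum_of hs)).1
  rw [vwpDual_seven_eq_tsum]
  exact hS.summable.tsum_pos (fun μ => (term_pos hle μ).le) 0 (term_pos hle 0)

/-- **Single-term lower bound**: `Z(b)·T̂(b,μ₀) ≤ F̃₇(b)` for every `μ₀`. -/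
theorem termNorm_mul_termHat_le_vwpDual (hle : ∀ j ∈ range 7, B j ≤ B₀) (hreg : ∀ j ∈ range 7, 2 * B j ≤ B₀ + 1) (hs : ∑ j ∈ range 7, B j ≤ 3 * B₀ + 1) (μ₀ : ℕ) :
    termNorm B₀ B * termHat B₀ B μ₀ ≤ vwpDual 7 (natB B₀ B) := by
  have hS := (vwp_decomposition (natB B₀ B) (inBox_natB hle) (hsum_of hs)).1
  rw [vwpDual_seven_eq_tsum, ← term_eq_normalised hle hreg μ₀]
  exact hS.summable.le_tsum μ₀ fun μ _ => (term_pos hle μ).le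

/-- **Upper-bound scheme**: if the normalised terms are bounded by a summable majorant `g` with `Σ g ≤ S`, then
`F̃₇(b) ≤ Z(b)·S`. -/
theorem vwpDual_seven_le_of_bounds (hle : ∀ j ∈ range 7, B j ≤ B₀) (hreg : ∀ j ∈ range 7, 2 * B j ≤ B₀ + 1) (hs : ∑ j ∈ range 7, B j ≤ 3 * B₀ + 1) {g : ℕ → ℝ} {S : ℝ}
    (hg : Summable g) (hgle : ∀ μ, termHat B₀ B μ ≤ g μ) (hS : ∑' μ, g μ ≤ S) :
    vwpDual 7 (natB B₀ B) ≤ termNorm B₀ B * S := by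
  have hsum := (vwp_decomposition (natB B₀ B) (inBox_natB hle) (hsum_of hs)).1
  rw [vwpDual_seven_eq_tsum]
  have e : (fun μ => term (natB B₀ B) μ) = fun μ => termNorm B₀ B * termHat B₀ B μ := funext (term_eq_normalised hle hreg)
  rw [show (∑' μ, term (natB B₀ B) μ) = ∑' μ, termNorm B₀ B * termHat B₀ B μ by rw [e], tsum_mul_left]
  refine mul_le_mul_of_nonneg_left ?_ (termNorm_pos B₀ B).le
  have hsum' : Summable (fun μ => termHat B₀ B μ) := by
    have := hsum.summable.mul_left (termNorm B₀ B)⁻¹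
    refine this.congr fun μ => ?_
    rw [term_eq_normalised hle hreg μ, ← mul_assoc, inv_mul_cancel₀ (termNorm_pos B₀ B).ne', one_mul]
  exact (hsum'.tsum_le_tsum hgle hg).trans hS

/-! ### The term ratio and monotone chains -/

/-- **Ratio identity**: `T̂(μ+1)·[(B₀+2μ+2)(μ+1)∏_j(B₀−B_j+μ+2)] = T̂(μ)·[(B₀+2μ+4)(B₀+μ+2)∏_j(B_j+μ+1)]`
(from `C(N+1,K+1)(K+1) = C(N,K)(N+1)`), in the region. -/
theorem termHat_succ_mul (hreg : ∀ j ∈ range 7, 2 * B j ≤ B₀ + 1) (μ : ℕ) :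
    termHat B₀ B (μ + 1) * (((B₀ + 2 * μ + 2 : ℕ) : ℝ) * ((μ + 1 : ℕ) : ℝ) *
        ∏ j ∈ range 7, ((B₀ - B j + μ + 2 : ℕ) : ℝ)) =
      termHat B₀ B μ * (((B₀ + 2 * μ + 4 : ℕ) : ℝ) * ((B₀ + μ + 2 : ℕ) : ℝ) *
        ∏ j ∈ range 7, ((B j + μ + 1 : ℕ) : ℝ)) := by
  unfold termHat
  -- numerator binomial: C(B₀+μ+2, μ+1)(μ+1) = C(B₀+μ+1, μ)(B₀+μ+2)
  have hN : (((B₀ + (μ + 1) + 1).choose (μ + 1) : ℕ) : ℝ) * ((μ + 1 : ℕ) : ℝ) =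
      (((B₀ + μ + 1).choose μ : ℕ) : ℝ) * ((B₀ + μ + 2 : ℕ) : ℝ) := by
    have e := Nat.add_one_mul_choose_eq (B₀ + μ + 1) μ
    rw [show B₀ + (μ + 1) + 1 = B₀ + μ + 1 + 1 by ring]
    have e' : (((B₀ + μ + 1 + 1).choose (μ + 1) : ℕ) : ℝ) * ((μ + 1 : ℕ) : ℝ) =
        ((B₀ + μ + 1 + 1 : ℕ) : ℝ) * (((B₀ + μ + 1).choose μ : ℕ) : ℝ) := by exact_mod_cast e.symm
    rw [e']; push_cast; ring
  -- denominator binomials: C(M+1, K+1)(K+1) = C(M, K)(M+1), `M = B₀−B_j+μ+1`, `K = B_j+μ`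
  have hD : ∀ j ∈ range 7, (((B₀ - B j + (μ + 1) + 1).choose (B j + (μ + 1)) : ℕ) : ℝ) * ((B j + μ + 1 : ℕ) : ℝ) =
      (((B₀ - B j + μ + 1).choose (B j + μ) : ℕ) : ℝ) * ((B₀ - B j + μ + 2 : ℕ) : ℝ) := by
    intro j hj
    have e := Nat.add_one_mul_choose_eq (B₀ - B j + μ + 1) (B j + μ)
    rw [show B₀ - B j + (μ + 1) + 1 = B₀ - B j + μ + 1 + 1 by ring, show B j + (μ + 1) = B j + μ + 1 by ring]
    have e' : (((B₀ - B j + μ + 1 + 1).choose (B j + μ + 1) : ℕ) : ℝ) * ((B j + μ + 1 : ℕ) : ℝ) =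
        ((B₀ - B j + μ + 1 + 1 : ℕ) : ℝ) * (((B₀ - B j + μ + 1).choose (B j + μ) : ℕ) : ℝ) := by exact_mod_cast e.symm
    rw [e']; push_cast; ring
  have hP : (∏ j ∈ range 7, (((B₀ - B j + (μ + 1) + 1).choose (B j + (μ + 1)) : ℕ) : ℝ)) *
      ∏ j ∈ range 7, ((B j + μ + 1 : ℕ) : ℝ) =
      (∏ j ∈ range 7, (((B₀ - B j + μ + 1).choose (B j + μ) : ℕ) : ℝ)) * ∏ j ∈ range 7, ((B₀ - B j + μ + 2 : ℕ) : ℝ) := by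
    rw [← prod_mul_distrib, ← prod_mul_distrib]; exact prod_congr rfl hD
  have hpos1 : (0 : ℝ) < ∏ j ∈ range 7, (((B₀ - B j + (μ + 1) + 1).choose (B j + (μ + 1)) : ℕ) : ℝ) :=
    prod_pos fun j hj => by have := hreg j hj; exact_mod_cast Nat.choose_pos (by omega)
  have hpos2 : (0 : ℝ) < ∏ j ∈ range 7, (((B₀ - B j + μ + 1).choose (B j + μ) : ℕ) : ℝ) :=
    prod_pos fun j hj => by have := hreg j hj; exact_mod_cast Nat.choose_pos (by omega)
  rw [div_mul_eq_mul_div, div_mul_eq_mul_div, div_eq_div_iff hpos1.ne' hpos2.ne']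
  have hc : ((B₀ + 2 * (μ + 1) + 2 : ℕ) : ℝ) = ((B₀ + 2 * μ + 4 : ℕ) : ℝ) := by push_cast; ring
  rw [hc]
  calc ((B₀ + 2 * μ + 4 : ℕ) : ℝ) * (((B₀ + (μ + 1) + 1).choose (μ + 1) : ℕ) : ℝ) *
        (((B₀ + 2 * μ + 2 : ℕ) : ℝ) * ((μ + 1 : ℕ) : ℝ) * ∏ j ∈ range 7, ((B₀ - B j + μ + 2 : ℕ) : ℝ)) *
        ∏ j ∈ range 7, (((B₀ - B j + μ + 1).choose (B j + μ) : ℕ) : ℝ)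
      = ((B₀ + 2 * μ + 4 : ℕ) : ℝ) * ((B₀ + 2 * μ + 2 : ℕ) : ℝ) *
        ((((B₀ + (μ + 1) + 1).choose (μ + 1) : ℕ) : ℝ) * ((μ + 1 : ℕ) : ℝ)) *
        ((∏ j ∈ range 7, (((B₀ - B j + μ + 1).choose (B j + μ) : ℕ) : ℝ)) *
          ∏ j ∈ range 7, ((B₀ - B j + μ + 2 : ℕ) : ℝ)) := by ring
    _ = ((B₀ + 2 * μ + 4 : ℕ) : ℝ) * ((B₀ + 2 * μ + 2 : ℕ) : ℝ) *
        ((((B₀ + μ + 1).choose μ : ℕ) : ℝ) * ((B₀ + μ + 2 : ℕ) : ℝ)) *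
        ((∏ j ∈ range 7, (((B₀ - B j + (μ + 1) + 1).choose (B j + (μ + 1)) : ℕ) : ℝ)) *
          ∏ j ∈ range 7, ((B j + μ + 1 : ℕ) : ℝ)) := by rw [hN, hP]
    _ = _ := by ring

/-- One step down: if `(B₀+2μ+4)(B₀+μ+2)∏(B_j+μ+1) ≤ (B₀+2μ+2)(μ+1)∏(B₀−B_j+μ+2)` then `T̂(μ+1) ≤ T̂(μ)`. -/
theorem termHat_succ_le (hreg : ∀ j ∈ range 7, 2 * B j ≤ B₀ + 1) {μ : ℕ}
    (hineq : ((B₀ + 2 * μ + 4 : ℕ) : ℝ) * ((B₀ + μ + 2 : ℕ) : ℝ) * ∏ j ∈ range 7, ((B j + μ + 1 : ℕ) : ℝ) ≤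
      ((B₀ + 2 * μ + 2 : ℕ) : ℝ) * ((μ + 1 : ℕ) : ℝ) * ∏ j ∈ range 7, ((B₀ - B j + μ + 2 : ℕ) : ℝ)) :
    termHat B₀ B (μ + 1) ≤ termHat B₀ B μ := by
  have e := termHat_succ_mul hreg μ
  have hX : (0 : ℝ) < ((B₀ + 2 * μ + 2 : ℕ) : ℝ) * ((μ + 1 : ℕ) : ℝ) * ∏ j ∈ range 7, ((B₀ - B j + μ + 2 : ℕ) : ℝ) :=
    mul_pos (by positivity) (prod_pos fun j _ => by positivity)
  have hT := (termHat_pos hreg μ).le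
  nlinarith [mul_le_mul_of_nonneg_left hineq hT]

/-- One step up: if `(B₀+2μ+2)(μ+1)∏(B₀−B_j+μ+2) ≤ (B₀+2μ+4)(B₀+μ+2)∏(B_j+μ+1)` then `T̂(μ) ≤ T̂(μ+1)`. -/
theorem termHat_le_succ (hreg : ∀ j ∈ range 7, 2 * B j ≤ B₀ + 1) {μ : ℕ}
    (hineq : ((B₀ + 2 * μ + 2 : ℕ) : ℝ) * ((μ + 1 : ℕ) : ℝ) * ∏ j ∈ range 7, ((B₀ - B j + μ + 2 : ℕ) : ℝ) ≤
      ((B₀ + 2 * μ + 4 : ℕ) : ℝ) * ((B₀ + μ + 2 : ℕ) : ℝ) * ∏ j ∈ range 7, ((B j + μ + 1 : ℕ) : ℝ)) :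
    termHat B₀ B μ ≤ termHat B₀ B (μ + 1) := by
  have e := termHat_succ_mul hreg μ
  have hY : (0 : ℝ) < ((B₀ + 2 * μ + 4 : ℕ) : ℝ) * ((B₀ + μ + 2 : ℕ) : ℝ) * ∏ j ∈ range 7, ((B j + μ + 1 : ℕ) : ℝ) :=
    mul_pos (by positivity) (prod_pos fun j _ => by positivity)
  have hT := (termHat_pos hreg (μ + 1)).le
  nlinarith [mul_le_mul_of_nonneg_left hineq hT]

/-- **Decreasing chain**: if `T̂(μ+1) ≤ T̂(μ)` for all `μ ≥ μ₁`, then `T̂(μ) ≤ T̂(μ₁)` for all `μ ≥ μ₁`. -/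
theorem termHat_le_of_decreasing {μ₁ : ℕ} (hstep : ∀ μ, μ₁ ≤ μ → termHat B₀ B (μ + 1) ≤ termHat B₀ B μ)
    {μ : ℕ} (hμ : μ₁ ≤ μ) : termHat B₀ B μ ≤ termHat B₀ B μ₁ := by
  induction μ, hμ using Nat.le_induction with
  | base => exact le_rfl
  | succ k hk ih => exact (hstep k hk).trans ih

/-- **Increasing chain**: if `T̂(μ) ≤ T̂(μ+1)` for all `μ < μ₂`, then `T̂(μ) ≤ T̂(μ₂)` for all `μ ≤ μ₂`. -/
theorem termHat_le_of_increasing {μ₂ : ℕ} (hstep : ∀ μ, μ < μ₂ → termHat B₀ B μ ≤ termHat B₀ B (μ + 1))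
    {μ : ℕ} (hμ : μ ≤ μ₂) : termHat B₀ B μ ≤ termHat B₀ B μ₂ := by
  obtain ⟨d, rfl⟩ := Nat.exists_eq_add_of_le hμ
  clear hμ
  induction d with
  | zero => simp
  | succ d ih =>
    have h1 := ih (fun ν hν => hstep ν (by omega))
    exact (le_trans (by simpa using h1) (hstep (μ + d) (by omega))).trans_eq (by ring_nf)

/-- **Polynomial tail majorant**: if `T̂(μ+1)(μ+2)² ≤ T̂(μ)(μ+1)²` for all `μ ≥ μ₃`, then
`T̂(μ) ≤ T̂(μ₃)·((μ₃+1)/(μ+1))²` for all `μ ≥ μ₃`. -/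
theorem termHat_le_of_tail {μ₃ : ℕ}
    (hstep : ∀ μ, μ₃ ≤ μ → termHat B₀ B (μ + 1) * ((μ : ℝ) + 2) ^ 2 ≤ termHat B₀ B μ * ((μ : ℝ) + 1) ^ 2)
    {μ : ℕ} (hμ : μ₃ ≤ μ) : termHat B₀ B μ ≤ termHat B₀ B μ₃ * (((μ₃ : ℝ) + 1) / ((μ : ℝ) + 1)) ^ 2 := by
  induction μ, hμ using Nat.le_induction with
  | base => rw [div_self (by positivity), one_pow, mul_one]
  | succ k hk ih =>
    have hs := hstep k hk
    have hk1 : (0 : ℝ) < (k : ℝ) + 1 := by positivity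
    have hk2 : (0 : ℝ) < (k : ℝ) + 2 := by positivity
    -- T̂(k+1) ≤ T̂(k)(k+1)²/(k+2)² ≤ T̂(μ₃)((μ₃+1)/(k+1))²(k+1)²/(k+2)²
    have h1 : termHat B₀ B (k + 1) ≤ termHat B₀ B k * ((k : ℝ) + 1) ^ 2 / ((k : ℝ) + 2) ^ 2 := by
      rw [le_div_iff₀ (by positivity)]; exact hs
    refine h1.trans ?_
    have h0 : 0 ≤ ((k : ℝ) + 1) ^ 2 / ((k : ℝ) + 2) ^ 2 := by positivity
    calc termHat B₀ B k * ((k : ℝ) + 1) ^ 2 / ((k : ℝ) + 2) ^ 2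
        = termHat B₀ B k * (((k : ℝ) + 1) ^ 2 / ((k : ℝ) + 2) ^ 2) := by ring
      _ ≤ termHat B₀ B μ₃ * (((μ₃ : ℝ) + 1) / ((k : ℝ) + 1)) ^ 2 * (((k : ℝ) + 1) ^ 2 / ((k : ℝ) + 2) ^ 2) :=
          mul_le_mul_of_nonneg_right ih h0
      _ = termHat B₀ B μ₃ * (((μ₃ : ℝ) + 1) / (((k + 1 : ℕ) : ℝ) + 1)) ^ 2 := by
          push_cast; field_simp; ring

/-- Abstract tail step: from the ratio identity `T₁·X = T₀·Y` with `X > 0`, `T₀ ≥ 0` and `Y·c ≤ X·d` conclude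
`T₁·c ≤ T₀·d`. -/
theorem le_of_ratio_identity {T₀ T₁ X Y c d : ℝ} (he : T₁ * X = T₀ * Y) (hX : 0 < X) (hT₀ : 0 ≤ T₀)
    (hYX : Y * c ≤ X * d) : T₁ * c ≤ T₀ * d := by
  have h1 : T₁ * c * X = T₀ * (Y * c) := by
    calc T₁ * c * X = (T₁ * X) * c := by ring
      _ = T₀ * (Y * c) := by rw [he]; ring
  have h2 : T₀ * (Y * c) ≤ T₀ * (X * d) := mul_le_mul_of_nonneg_left hYX hT₀
  have h3 : T₁ * c * X ≤ T₀ * d * X := by rw [h1]; linarith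
  exact le_of_mul_le_mul_right h3 hX

/-- **Upper bound by partial sums**: if every partial sum of the normalised terms is `≤ S`, then `F̃₇(b) ≤ Z(b)·S`. -/
theorem vwpDual_seven_le_of_partial_sums (hle : ∀ j ∈ range 7, B j ≤ B₀) (hreg : ∀ j ∈ range 7, 2 * B j ≤ B₀ + 1) (hs : ∑ j ∈ range 7, B j ≤ 3 * B₀ + 1) {S : ℝ}
    (hS : ∀ N, ∑ μ ∈ range N, termHat B₀ B μ ≤ S) : vwpDual 7 (natB B₀ B) ≤ termNorm B₀ B * S := by
  have hsum := (vwp_decomposition (natB B₀ B) (inBox_natB hle) (hsum_of hs)).1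
  rw [vwpDual_seven_eq_tsum]
  have e : (fun μ => term (natB B₀ B) μ) = fun μ => termNorm B₀ B * termHat B₀ B μ := funext (term_eq_normalised hle hreg)
  rw [show (∑' μ, term (natB B₀ B) μ) = ∑' μ, termNorm B₀ B * termHat B₀ B μ by rw [e], tsum_mul_left]
  refine mul_le_mul_of_nonneg_left ?_ (termNorm_pos B₀ B).le
  exact tsum_le_of_sum_range_le (fun μ => (termHat_pos hreg μ).le) hS

end Summit.KontsevichZagierPeriods.Zeta5Search.DualSeriesBounds
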